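import Literature.AlgebraicTopology.FundamentalGroup.FreeGroupPuncturedPlane
import Literature.AlgebraicTopology.FundamentalGroup.TorusMinusFiniteFundamentalGroup
import Mathlib.GroupTheory.Perm.Fin
import HarnessLib

/-!
# The fundamental groups of the plane minus `≥ 2` points and of the torus minus `≥ 1` point are
# non-abelian

Topic `Literature/AlgebraicTopology/FundamentalGroup`.  A. Hatcher, *Algebraic Topology* (2002), §1.2
Examples 1.21–1.22 compute `π₁(ℂ ∖ F) ≅ F_{|F|}` and `π₁(T² ∖ S) ≅ F_{|S|+1}` (the tree's
`nonempty_mulEquiv_freeGroup_compl_finite`, `TorusMinusFinite.nonempty_mulEquiv_freeGroup_compl_finite`);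
a free group on `≥ 2` generators is non-abelian (Lyndon–Schupp I Prop. 2.16: two distinct basis
elements do not commute — seen in `S₃`).  We record the consequence used as the INPUT «`π₁` non-abelian»
of the uniformization-by-the-disc theorems of hyperbolic curves (e.g.
`Literature.AnabelianGeometry.AbsoluteAnabelian.exists_disc_covering_of_nonabelian_fundamentalGroup_holds`,
[AbsTopIII] Cor. 2.4 at genuine curves): at genus `0` with `≥ 3` punctures and genus `1` with `≥ 1`
puncture the fundamental group is non-abelian, by a kernel computation rather than by hypothesis.

* `FreeGroup.of_mul_of_ne_mul_of` — `of a * of b ≠ of b * of a` for `a ≠ b`;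
* `exists_mul_ne_mul_of_mulEquiv_freeGroup` — a group isomorphic to `FreeGroup (Fin n)`, `2 ≤ n`, is
  non-abelian;
* `exists_mul_ne_mul_fundamentalGroup_compl_finite` — `π₁(ℂ ∖ F, x)` is non-abelian for finite `F`
  with `2 ≤ |F|` (type `(0, r)`, `r ≥ 3`);
* `TorusMinusFinite.exists_mul_ne_mul_fundamentalGroup_compl_finite` — `π₁((ℝ/ℤ)² ∖ S, y)` is non-abelian
  for finite non-empty `S` (type `(1, r)`, `r ≥ 1`).

PROOF-ONLY: no definitions, no named facts; classical.
-/

noncomputable section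

open Set Function

namespace Literature.AlgebraicTopology.FundamentalGroup

/-- **Two distinct basis elements of a free group do not commute** (Lyndon–Schupp I Prop. 2.16):
map `a ↦ (0 1)`, `b ↦ (1 2)` in `S₃ = Perm (Fin 3)`, everything else to `1`; the two transpositions do
not commute. [cite: LyndonSchupp2001, Ch. I Prop. 2.16] -/
theorem FreeGroup.of_mul_of_ne_mul_of {α : Type*} {a b : α} (hab : a ≠ b) :
    FreeGroup.of a * FreeGroup.of b ≠ FreeGroup.of b * FreeGroup.of a := by
  classical
  let f : α → Equiv.Perm (Fin 3) := fun c =>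
    if c = a then Equiv.swap 0 1 else if c = b then Equiv.swap 1 2 else 1
  have hfa : f a = Equiv.swap 0 1 := by simp [f]
  have hfb : f b = Equiv.swap 1 2 := by simp [f, Ne.symm hab]
  intro h
  have h' := congrArg (FreeGroup.lift f) h
  simp only [map_mul, FreeGroup.lift_apply_of, hfa, hfb] at h'
  exact absurd h' (by decide)

/-- **A group isomorphic to a free group of rank `≥ 2` is non-abelian.**
[cite: LyndonSchupp2001, Ch. I Prop. 2.16] -/
theorem exists_mul_ne_mul_of_mulEquiv_freeGroup {G : Type*} [Group G] {n : ℕ} (hn : 2 ≤ n)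
    (e : G ≃* FreeGroup (Fin n)) : ∃ a b : G, a * b ≠ b * a := by
  refine ⟨e.symm (FreeGroup.of ⟨0, by omega⟩), e.symm (FreeGroup.of ⟨1, by omega⟩), fun h => ?_⟩
  have h' := congrArg e h
  simp only [map_mul, MulEquiv.apply_symm_apply] at h'
  exact FreeGroup.of_mul_of_ne_mul_of (by simp [Fin.ext_iff]) h'

/-- **The fundamental group of the plane with `≥ 2` punctures is non-abelian** (`π₁(ℂ ∖ F) ≅ F_{|F|}`,
Hatcher Example 1.21, and a free group of rank `≥ 2` is non-abelian): the «non-abelian `π₁`» input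
of the disc-uniformization of hyperbolic curves, at type `(0, r)`, `r ≥ 3`.
[cite: HatcherAT2002, §1.2 Example 1.21] -/
theorem exists_mul_ne_mul_fundamentalGroup_compl_finite {F : Set ℂ} (hF : F.Finite)
    (h2 : 2 ≤ F.ncard) (x : ↥(Fᶜ)) :
    ∃ a b : _root_.FundamentalGroup (↥(Fᶜ)) x, a * b ≠ b * a := by
  obtain ⟨e⟩ := nonempty_mulEquiv_freeGroup_compl_finite hF x
  exact exists_mul_ne_mul_of_mulEquiv_freeGroup h2 e

namespace TorusMinusFinite

variable {ι : Type*} [DecidableEq ι] {i₀ i₁ : ι}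

/-- **The fundamental group of the torus with `≥ 1` puncture is non-abelian** (`π₁(T ∖ S) ≅ F_{|S|+1}`,
Hatcher Example 1.22, rank `|S| + 1 ≥ 2`): the «non-abelian `π₁`» input at type `(1, r)`, `r ≥ 1`, for
the square torus `T = (ℝ/ℤ)^ι`, `ι = {i₀, i₁}`. [cite: HatcherAT2002, §1.2 Example 1.22] -/
theorem exists_mul_ne_mul_fundamentalGroup_compl_finite (hne : i₀ ≠ i₁) (hι : ∀ i, i = i₀ ∨ i = i₁)
    {S : Set (ι → AddCircle (1 : ℝ))} (hS : S.Finite) (hSne : S.Nonempty) (y : ↥(Sᶜ)) :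
    ∃ a b : _root_.FundamentalGroup (↥(Sᶜ)) y, a * b ≠ b * a := by
  obtain ⟨e⟩ := nonempty_mulEquiv_freeGroup_compl_finite hne hι hS hSne y
  have h1 : 1 ≤ S.ncard := (Set.ncard_pos hS).2 hSne
  exact exists_mul_ne_mul_of_mulEquiv_freeGroup (by omega) e

end TorusMinusFinite

end Literature.AlgebraicTopology.FundamentalGroup

end
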